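import Summits.AtomisticToContinuum.Crystallization.Theorems.ExcessDecayLiouvilleCutoff

/-!
# Route `ExcessDecayLiouville`: vertical differences are dominated by the strain form

Step (c3) ingredient of the energy route for item `ExcessDecay` (stmt-AtomisticToContinuum-9334).  Inside one
sublattice the vertical period `w₃ = 2√(2/3)e₃ ∈ Λ₀` is NOT a nearest-neighbour translation (`‖A w₃‖ ≈ 1.6 > 11/10`), so
`nnForm` does not dominate the vertical differences `v(p + A w₃) − v(p)` termwise.  It does after two steps through the
other sublattice: the map `σ` sending a site `t₀ + Az` to `t₁ + Az` and a site `t₁ + Az` to `t₀ + A(z + w₃)` is an injective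
self-map of the sites with `dist p (σ p) ≤ 11/10` and `σ (σ p) = p + A w₃`, whence

`Σ'_p ‖v p − v (p + A w₃)‖² ≤ 4 · nnForm t A v`   (`tsum_norm_sub_vertical_sq_le_nnForm`)

for finitely supported `v` (`tsum_norm_sub_map_sq_le_nnForm` twice).  With the in-plane nearest-neighbour translations
`±u₁, ±u₂` (`‖A u_i‖ ≤ 199/200`) this gives `ℓ²` control of the full discrete gradient in lattice coordinates.
All `[folklore]`; helper lemmas, nothing here closes an item.
-/

noncomputable section

namespace Summit.AtomisticToContinuum.Crystallization.Theorems.ExcessDecayLiouville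

open scoped BigOperators Topology InnerProductSpace RealInnerProductSpace Classical
open Literature.MathematicalPhysics.StatisticalMechanics
open Summit.AtomisticToContinuum.Crystallization.Theorems.PhononStabilityNegative

section

variable {t : Fin 2 → (EuclideanSpace ℝ (Fin 3))} {A : (EuclideanSpace ℝ (Fin 3)) →L[ℝ] (EuclideanSpace ℝ (Fin 3))}

/-- The vertical period `w₃ = 2√(2/3)e₃` lies in `Λ₀`. [folklore] -/
theorem layerNormal_two_mem_Λ₀ : layerNormal (2 * Real.sqrt (2 / 3)) ∈ Λ₀ :=
  ⟨0, 0, 1, by simp⟩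

/-- Coordinates of the hcp motif vector `w + √(2/3)e₃ = (1/2, √3/6, √(2/3))`. [folklore] -/
theorem motif_apply :
    (barlowOffset 1 + layerNormal (Real.sqrt (2 / 3)) : (EuclideanSpace ℝ (Fin 3))) 0 = 1 / 2 ∧
    (barlowOffset 1 + layerNormal (Real.sqrt (2 / 3)) : (EuclideanSpace ℝ (Fin 3))) 1 = √3 / 6 ∧
    (barlowOffset 1 + layerNormal (Real.sqrt (2 / 3)) : (EuclideanSpace ℝ (Fin 3))) 2 = Real.sqrt (2 / 3) := by
  refine ⟨?_, ?_, ?_⟩ <;> simp [barlowOffset, layerNormal]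

/-- Coordinates of `w₃ − (w + √(2/3)e₃) = (−1/2, −√3/6, √(2/3))`. [folklore] -/
theorem layerNormal_two_sub_motif_apply :
    (layerNormal (2 * Real.sqrt (2 / 3)) - (barlowOffset 1 + layerNormal (Real.sqrt (2 / 3))) : (EuclideanSpace ℝ (Fin 3))) 0 = -(1 / 2) ∧
    (layerNormal (2 * Real.sqrt (2 / 3)) - (barlowOffset 1 + layerNormal (Real.sqrt (2 / 3))) : (EuclideanSpace ℝ (Fin 3))) 1 = -(√3 / 6) ∧
    (layerNormal (2 * Real.sqrt (2 / 3)) - (barlowOffset 1 + layerNormal (Real.sqrt (2 / 3))) : (EuclideanSpace ℝ (Fin 3))) 2 = Real.sqrt (2 / 3) := by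
  refine ⟨?_, ?_, ?_⟩
  · simp [barlowOffset, layerNormal]
  · simp [barlowOffset, layerNormal]
  · simp [barlowOffset, layerNormal]; ring

/-- `‖w + √(2/3)e₃‖ = 1` (the hcp motif vector is a unit vector for unit lattice constant). [folklore] -/
theorem norm_motif : ‖(barlowOffset 1 + layerNormal (Real.sqrt (2 / 3)) : (EuclideanSpace ℝ (Fin 3)))‖ = 1 := by
  have s3 : (√3 : ℝ) ^ 2 = 3 := Real.sq_sqrt (by norm_num)
  have s23 : (Real.sqrt (2 / 3)) ^ 2 = 2 / 3 := Real.sq_sqrt (by norm_num)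
  obtain ⟨h0, h1, h2⟩ := motif_apply
  have hsq : ‖(barlowOffset 1 + layerNormal (Real.sqrt (2 / 3)) : (EuclideanSpace ℝ (Fin 3)))‖ ^ 2 = 1 := by
    rw [EuclideanSpace.norm_sq_eq, Fin.sum_univ_three]
    simp only [Real.norm_eq_abs, sq_abs]
    rw [h0, h1, h2]
    nlinarith [s3, s23]
  have hn : 0 ≤ ‖(barlowOffset 1 + layerNormal (Real.sqrt (2 / 3)) : (EuclideanSpace ℝ (Fin 3)))‖ := norm_nonneg _
  nlinarith [hsq, hn]

/-- `‖w₃ − (w + √(2/3)e₃)‖ = 1` (the second step of the vertical two-step path is a unit vector too). [folklore] -/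
theorem norm_layerNormal_two_sub_motif :
    ‖(layerNormal (2 * Real.sqrt (2 / 3)) - (barlowOffset 1 + layerNormal (Real.sqrt (2 / 3))) : (EuclideanSpace ℝ (Fin 3)))‖ = 1 := by
  have s3 : (√3 : ℝ) ^ 2 = 3 := Real.sq_sqrt (by norm_num)
  have s23 : (Real.sqrt (2 / 3)) ^ 2 = 2 / 3 := Real.sq_sqrt (by norm_num)
  obtain ⟨h0, h1, h2⟩ := layerNormal_two_sub_motif_apply
  have hsq : ‖(layerNormal (2 * Real.sqrt (2 / 3)) - (barlowOffset 1 + layerNormal (Real.sqrt (2 / 3))) : (EuclideanSpace ℝ (Fin 3)))‖ ^ 2 = 1 := by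
    rw [EuclideanSpace.norm_sq_eq, Fin.sum_univ_three]
    simp only [Real.norm_eq_abs, sq_abs]
    rw [h0, h1, h2]
    nlinarith [s3, s23]
  have hn : 0 ≤ ‖(layerNormal (2 * Real.sqrt (2 / 3)) - (barlowOffset 1 + layerNormal (Real.sqrt (2 / 3))) : (EuclideanSpace ℝ (Fin 3)))‖ :=
    norm_nonneg _
  nlinarith [hsq, hn]

/-- The inter-sublattice step `t₁ − t₀` has length `≤ 199/200 + 1/40 ≤ 11/10`. [folklore] -/
theorem norm_t_sub_t_le (hA : Adm₀ A) (hI : Inner₀ t A) : ‖t 1 - t 0‖ ≤ 11 / 10 := by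
  have h1 : ‖A (barlowOffset 1 + layerNormal (Real.sqrt (2 / 3)))‖ ≤ 199 / 200 := by
    have := norm_apply_le_of_adm₀ hA (barlowOffset 1 + layerNormal (Real.sqrt (2 / 3)))
    rw [norm_motif, mul_one] at this
    exact this
  have h2 : ‖t 1 - t 0 - A (barlowOffset 1 + layerNormal (Real.sqrt (2 / 3)))‖ ≤ 1 / 40 := hI
  have := norm_sub_le_norm_sub_add_norm_sub (t 1 - t 0) (A (barlowOffset 1 + layerNormal (Real.sqrt (2 / 3)))) 0
  rw [sub_zero, sub_zero] at this
  linarith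

/-- The complementary step `A w₃ − (t₁ − t₀)` has length `≤ 11/10` as well. [folklore] -/
theorem norm_Aw₃_sub_le (hA : Adm₀ A) (hI : Inner₀ t A) :
    ‖A (layerNormal (2 * Real.sqrt (2 / 3))) - (t 1 - t 0)‖ ≤ 11 / 10 := by
  have h1 : ‖A (layerNormal (2 * Real.sqrt (2 / 3)) - (barlowOffset 1 + layerNormal (Real.sqrt (2 / 3))))‖ ≤ 199 / 200 := by
    have := norm_apply_le_of_adm₀ hA (layerNormal (2 * Real.sqrt (2 / 3)) - (barlowOffset 1 + layerNormal (Real.sqrt (2 / 3))))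
    rw [norm_layerNormal_two_sub_motif, mul_one] at this
    exact this
  have h2 : ‖t 1 - t 0 - A (barlowOffset 1 + layerNormal (Real.sqrt (2 / 3)))‖ ≤ 1 / 40 := hI
  have heq : A (layerNormal (2 * Real.sqrt (2 / 3))) - (t 1 - t 0) =
      A (layerNormal (2 * Real.sqrt (2 / 3)) - (barlowOffset 1 + layerNormal (Real.sqrt (2 / 3)))) -
        (t 1 - t 0 - A (barlowOffset 1 + layerNormal (Real.sqrt (2 / 3)))) := by
    rw [map_sub]; abel
  rw [heq]
  exact (norm_sub_le _ _).trans (by linarith)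

/-- Sites of sublattice `0` and sublattice `1` never coincide. [folklore] -/
theorem sublattice_ne (hA : Adm₀ A) (hI : Inner₀ t A) {z z' : (EuclideanSpace ℝ (Fin 3))} (hz : z ∈ Λ₀) (hz' : z' ∈ Λ₀) :
    t 0 + A z ≠ t 1 + A z' := by
  intro h
  have := dist_sites_cross_ge hA hI hz hz'
  rw [← h, dist_self] at this
  norm_num at this

/-- **The vertical two-step map.** An injective self-map `σ` of the sites with `dist p (σ p) ≤ 11/10` and
`σ (σ p) = p + A w₃`. [folklore] -/
theorem exists_verticalStep (hA : Adm₀ A) (hI : Inner₀ t A) :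
    ∃ σ : Sites₀ t A → Sites₀ t A, Function.Injective σ ∧
      (∀ p : Sites₀ t A, dist (p : (EuclideanSpace ℝ (Fin 3))) (σ p) ≤ 11 / 10) ∧
      (∀ p : Sites₀ t A, ((σ (σ p) : Sites₀ t A) : (EuclideanSpace ℝ (Fin 3))) = (p : (EuclideanSpace ℝ (Fin 3))) + A (layerNormal (2 * Real.sqrt (2 / 3)))) := by
  classical
  set w₃ : (EuclideanSpace ℝ (Fin 3)) := layerNormal (2 * Real.sqrt (2 / 3)) with hw₃
  set d : (EuclideanSpace ℝ (Fin 3)) := t 1 - t 0 with hd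
  -- membership facts
  have hmem0 : ∀ p : Sites₀ t A, (∃ z ∈ Λ₀, (p : (EuclideanSpace ℝ (Fin 3))) = t 0 + A z) → (p : (EuclideanSpace ℝ (Fin 3))) + d ∈ Sites₀ t A := by
    rintro p ⟨z, hz, hp⟩
    exact ⟨1, z, hz, by rw [hp, hd]; abel⟩
  have hmem1 : ∀ p : Sites₀ t A, (¬ ∃ z ∈ Λ₀, (p : (EuclideanSpace ℝ (Fin 3))) = t 0 + A z) → (p : (EuclideanSpace ℝ (Fin 3))) + (A w₃ - d) ∈ Sites₀ t A := by
    intro p hp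
    obtain ⟨m, z, hz, hpz⟩ := p.2
    fin_cases m
    · exact absurd ⟨z, hz, hpz⟩ hp
    · have hpz' : (p : (EuclideanSpace ℝ (Fin 3))) = t 1 + A z := by simpa using hpz
      have h0 : t 0 + A z ∈ Sites₀ t A := ⟨0, z, hz, rfl⟩
      have := add_mem_sites₀ h0 layerNormal_two_mem_Λ₀
      convert this using 1
      rw [hpz', hd, hw₃]; abel
  let σ : Sites₀ t A → Sites₀ t A := fun p =>
    if h : ∃ z ∈ Λ₀, (p : (EuclideanSpace ℝ (Fin 3))) = t 0 + A z then ⟨(p : (EuclideanSpace ℝ (Fin 3))) + d, hmem0 p h⟩ else ⟨(p : (EuclideanSpace ℝ (Fin 3))) + (A w₃ - d), hmem1 p h⟩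
  have hσ0 : ∀ p : Sites₀ t A, (∃ z ∈ Λ₀, (p : (EuclideanSpace ℝ (Fin 3))) = t 0 + A z) → ((σ p : Sites₀ t A) : (EuclideanSpace ℝ (Fin 3))) = (p : (EuclideanSpace ℝ (Fin 3))) + d := by
    intro p h; simp only [σ, dif_pos h]
  have hσ1 : ∀ p : Sites₀ t A, (¬ ∃ z ∈ Λ₀, (p : (EuclideanSpace ℝ (Fin 3))) = t 0 + A z) → ((σ p : Sites₀ t A) : (EuclideanSpace ℝ (Fin 3))) = (p : (EuclideanSpace ℝ (Fin 3))) + (A w₃ - d) := by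
    intro p h; simp only [σ, dif_neg h]
  -- images: sublattice 0 goes to sublattice 1 (not 0), sublattice 1 goes to sublattice 0
  have himg0 : ∀ p : Sites₀ t A, (∃ z ∈ Λ₀, (p : (EuclideanSpace ℝ (Fin 3))) = t 0 + A z) → ¬ ∃ z ∈ Λ₀, ((σ p : Sites₀ t A) : (EuclideanSpace ℝ (Fin 3))) = t 0 + A z := by
    rintro p ⟨z, hz, hp⟩ ⟨z', hz', h'⟩
    rw [hσ0 p ⟨z, hz, hp⟩, hp, hd] at h'
    have : t 1 + A z = t 0 + A z' := by rw [← h']; abel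
    exact sublattice_ne hA hI hz' hz this.symm
  have himg1 : ∀ p : Sites₀ t A, (¬ ∃ z ∈ Λ₀, (p : (EuclideanSpace ℝ (Fin 3))) = t 0 + A z) → ∃ z ∈ Λ₀, ((σ p : Sites₀ t A) : (EuclideanSpace ℝ (Fin 3))) = t 0 + A z := by
    intro p hp
    obtain ⟨m, z, hz, hpz⟩ := p.2
    fin_cases m
    · exact absurd ⟨z, hz, hpz⟩ hp
    · have hpz' : (p : (EuclideanSpace ℝ (Fin 3))) = t 1 + A z := by simpa using hpz
      refine ⟨z + w₃, hcpLiouvilleLam_add_mem hz layerNormal_two_mem_Λ₀, ?_⟩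
      rw [hσ1 p hp, hpz', hd, map_add]; abel
  refine ⟨σ, ?_, ?_, ?_⟩
  · -- injective
    intro p q hpq
    have hv : ((σ p : Sites₀ t A) : (EuclideanSpace ℝ (Fin 3))) = ((σ q : Sites₀ t A) : (EuclideanSpace ℝ (Fin 3))) := congrArg Subtype.val hpq
    by_cases hp : ∃ z ∈ Λ₀, (p : (EuclideanSpace ℝ (Fin 3))) = t 0 + A z
    · by_cases hq : ∃ z ∈ Λ₀, (q : (EuclideanSpace ℝ (Fin 3))) = t 0 + A z
      · rw [hσ0 p hp, hσ0 q hq] at hv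
        exact Subtype.ext (add_right_cancel hv)
      · exact absurd (hpq ▸ himg1 q hq) (himg0 p hp)
    · by_cases hq : ∃ z ∈ Λ₀, (q : (EuclideanSpace ℝ (Fin 3))) = t 0 + A z
      · exact absurd (hpq ▸ himg0 q hq) (fun h => h (himg1 p hp))
      · rw [hσ1 p hp, hσ1 q hq] at hv
        exact Subtype.ext (add_right_cancel hv)
  · -- short
    intro p
    by_cases hp : ∃ z ∈ Λ₀, (p : (EuclideanSpace ℝ (Fin 3))) = t 0 + A z
    · rw [hσ0 p hp, dist_eq_norm, sub_add_cancel_left, norm_neg, hd]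
      exact norm_t_sub_t_le hA hI
    · rw [hσ1 p hp, dist_eq_norm, sub_add_cancel_left, norm_neg, hd, hw₃]
      exact norm_Aw₃_sub_le hA hI
  · -- two steps = vertical period
    intro p
    by_cases hp : ∃ z ∈ Λ₀, (p : (EuclideanSpace ℝ (Fin 3))) = t 0 + A z
    · rw [hσ1 (σ p) (himg0 p hp), hσ0 p hp]; abel
    · rw [hσ0 (σ p) (himg1 p hp), hσ1 p hp]; abel

/-- **Vertical differences are dominated by the strain form**:
`Σ'_p ‖v p − v (p + A w₃)‖² ≤ 4 · nnForm t A v` for finitely supported `v`. [folklore] -/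
theorem tsum_norm_sub_vertical_sq_le_nnForm (hA : Adm₀ A) (hI : Inner₀ t A)
    {v : (EuclideanSpace ℝ (Fin 3)) → (EuclideanSpace ℝ (Fin 3))} (hv : (Function.support v).Finite) :
    ∑' p : Sites₀ t A, ‖v p - v ((p : (EuclideanSpace ℝ (Fin 3))) + A (layerNormal (2 * Real.sqrt (2 / 3))))‖ ^ 2 ≤ 4 * nnForm t A v := by
  classical
  obtain ⟨σ, hσi, hσd, hσσ⟩ := exists_verticalStep hA hI
  have hS : Summable (fun p : Sites₀ t A => ‖v p - v (σ p)‖ ^ 2) := summable_norm_sub_map_sq hv hσi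
  have hmain := tsum_norm_sub_map_sq_le_nnForm hA hI hv hσi hσd
  -- the second step, reindexed along σ
  have hS2 : Summable (fun p : Sites₀ t A => ‖v (σ p) - v (σ (σ p))‖ ^ 2) :=
    (hS.comp_injective hσi)
  have h2 : ∑' p : Sites₀ t A, ‖v (σ p) - v (σ (σ p))‖ ^ 2 ≤ ∑' p : Sites₀ t A, ‖v p - v (σ p)‖ ^ 2 :=
    tsum_comp_le_tsum_of_inj hS (fun p => sq_nonneg _) hσi
  -- termwise: ‖a − c‖² ≤ 2‖a − b‖² + 2‖b − c‖²
  have hterm : ∀ p : Sites₀ t A, ‖v p - v ((p : (EuclideanSpace ℝ (Fin 3))) + A (layerNormal (2 * Real.sqrt (2 / 3))))‖ ^ 2 ≤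
      2 * ‖v p - v (σ p)‖ ^ 2 + 2 * ‖v (σ p) - v (σ (σ p))‖ ^ 2 := by
    intro p
    rw [← hσσ p]
    have h := norm_add_le (v p - v (σ p)) (v (σ p) - v (σ (σ p)))
    rw [sub_add_sub_cancel] at h
    have hc := norm_nonneg (v p - v (σ (σ p)))
    have h' := pow_le_pow_left₀ hc h 2
    nlinarith [h', sq_nonneg (‖v p - v (σ p)‖ - ‖v (σ p) - v (σ (σ p))‖)]
  have hL : Summable (fun p : Sites₀ t A => ‖v p - v ((p : (EuclideanSpace ℝ (Fin 3))) + A (layerNormal (2 * Real.sqrt (2 / 3))))‖ ^ 2) := by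
    refine Summable.of_nonneg_of_le (fun p => sq_nonneg _) hterm ?_
    exact (hS.mul_left 2).add (hS2.mul_left 2)
  calc ∑' p : Sites₀ t A, ‖v p - v ((p : (EuclideanSpace ℝ (Fin 3))) + A (layerNormal (2 * Real.sqrt (2 / 3))))‖ ^ 2
      ≤ ∑' p : Sites₀ t A, (2 * ‖v p - v (σ p)‖ ^ 2 + 2 * ‖v (σ p) - v (σ (σ p))‖ ^ 2) :=
        hL.tsum_le_tsum hterm ((hS.mul_left 2).add (hS2.mul_left 2))
    _ = 2 * ∑' p : Sites₀ t A, ‖v p - v (σ p)‖ ^ 2 + 2 * ∑' p : Sites₀ t A, ‖v (σ p) - v (σ (σ p))‖ ^ 2 := by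
        rw [(hS.mul_left 2).tsum_add (hS2.mul_left 2), tsum_mul_left, tsum_mul_left]
    _ ≤ 4 * nnForm t A v := by linarith

end

end Summit.AtomisticToContinuum.Crystallization.Theorems.ExcessDecayLiouville

end
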